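import Summits.CriticalPhenomena.PercolationContinuityZ3.Theorems.PercLowPointHalfSpaceTallClusterMassBoundTightnessGlue

/-!
# Line `SketchIdeator4`, crux `TallClusterMassBound` (stmt-CriticalPhenomena-0912): the open stub C⁺ in ROUTE VOCABULARY

For the planner's `promote-stub` / `set-signature` of C⁺ = `stub_halfBoxTypicalMax` (the ONLY open stub of the line; everything
else is in the tree). A Theses file cannot mention the Theorems-level abbreviation `halfBox`, so the candidate item statement below
spells the half-box out as `(box 3 r).filter (0 ≤ · 0)` and qualifies every constant as the gate prints route items.

* `HalfBoxTypicalMaxRoute` — the candidate item statement (Literature constants only).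
* `halfBoxTypicalMaxRoute_iff_stub : HalfBoxTypicalMaxRoute ↔ <registered signature of stub_halfBoxTypicalMax>` — `Iff.rfl`.
* `tallClusterMassBound_of_halfBoxTypicalMaxRoute : HalfBoxTypicalMaxRoute → TallClusterMassBound` — the landed glue
  `tallClusterMassBound_of_halfBoxTypicalMax` (p112819), so promoting C⁺ closes B MODULO the new item with no further Lean work.
-/

noncomputable section

open MeasureTheory Finset
open Literature.Probability.Percolation Literature.Probability.LatticeModels
open Summit.CriticalPhenomena.PercolationContinuityZ3.Theses.PercLowPointHalfSpace (TallClusterMassBound)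
open Summit.CriticalPhenomena.PercolationContinuityZ3.Theorems.TallClusterMassBound.Negative
open Summit.CriticalPhenomena.PercolationContinuityZ3.Theorems.TallClusterMassBound.TightnessLine

namespace Summit.CriticalPhenomena.PercolationContinuityZ3.Cruxes.TallClusterMassBound.TightnessLine.Promote

/-- **C⁺ as a route item (candidate signature).** At `p_c(ℤ³)`, the typical value (Hutchcroft's `1/e`-quantile) of the largest
cluster volume of bond percolation on the INDUCED half-space `ℍ = {x₀ ≥ 0}` inside the half-box `Λ_r = B_r ∩ ℍ` is `≤ C r^s` for
some `s < 11/4`: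
`∃ s < 11/4, ∃ C, ∀ r ≥ 1, typicalMax (floorDilutedPercolation 3 (criticalProbI 3) 1) ((box 3 r).filter (0 ≤ · 0)) ≤ C r^s`.
Heuristic truth `s = d_f ≈ 2.52`; false at `p = 1`. [folklore] -/
def HalfBoxTypicalMaxRoute : Prop :=
  ∃ s : ℝ, s < (11 : ℝ) / 4 ∧ ∃ C : ℝ, ∀ r : ℕ, 1 ≤ r →
    ((Literature.Probability.Percolation.typicalMax
        (Literature.Probability.Percolation.floorDilutedPercolation 3
          (Literature.Probability.Percolation.criticalProbI 3) 1)
        ((Literature.Probability.LatticeModels.box 3 r).filter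
          fun x : Literature.Probability.LatticeModels.Site 3 => 0 ≤ x 0) : ℕ) : ℝ) ≤
      C * (r : ℝ) ^ s

/-- The candidate item statement is DEFINITIONALLY the registered stub `stub_halfBoxTypicalMax` of
`Cruxes/TallClusterMassBound/Lines/SketchIdeator4.lean` (`halfBox r = (box 3 r).filter (0 ≤ · 0)`). [folklore] -/
theorem halfBoxTypicalMaxRoute_iff_stub :
    HalfBoxTypicalMaxRoute ↔
      (∃ s : ℝ, s < (11 : ℝ) / 4 ∧ ∃ C : ℝ, ∀ r : ℕ, 1 ≤ r →
        (typicalMax (floorDilutedPercolation 3 (criticalProbI 3) 1) (halfBox r) : ℝ) ≤ C * (r : ℝ) ^ s) :=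
  Iff.rfl

/-- Promoting C⁺ closes B modulo the new item: the landed glue `tallClusterMassBound_of_halfBoxTypicalMax` (p112819) applied to
the route-vocabulary form. [folklore] -/
theorem tallClusterMassBound_of_halfBoxTypicalMaxRoute (h : HalfBoxTypicalMaxRoute) : TallClusterMassBound :=
  tallClusterMassBound_of_halfBoxTypicalMax (halfBoxTypicalMaxRoute_iff_stub.1 h)

end Summit.CriticalPhenomena.PercolationContinuityZ3.Cruxes.TallClusterMassBound.TightnessLine.Promote
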